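import Summits.RiemannHypothesis.RiemannHypothesis.Theorems.SoloInformedGroundStateDecay2
import Summits.RiemannHypothesis.RiemannHypothesis.Theorems.HandoffWeilEnergyExplicitEndgame
import Summits.RiemannHypothesis.RiemannHypothesis.Theorems.HandoffRouteEWindow

/-!
# Handoff (rh-explicit, prove-1), Route E: the assembly — an explicit, RH-free ground-energy bound from an explicit seed

Kernel form, modulo the seed, of the cell's paper THEOREM E♭ (handoff/prove-1 ATTEMPT-11): Solo's
parts XII–XVI (`weilGroundEnergy_exp_exp_decay`, ineffective rate) re-run with

* a seed `h` handed in through HYPOTHESES — even Schwartz, `h(0) = 0 = ∫ h`, `h = 0` on `(1, ∞)`, and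
  the SUMMABLE Fourier envelope `‖𝓕h(ξ)‖ ≤ A ξ⁻²` for `ξ ≥ λ²` that part XII-quant consumes
  (`norm_eMapFn_le_of_fourier_decay` with threshold `X = λ²`);
* the Route E window `winTestW h λ θ` (cutoff transition on `[θ/λ, 1/λ]`, `HandoffRouteEWindow`), so that
  the tail lives on `(0, 1/λ]` where the envelope applies at full strength;
* the mollifier `φ_k` of radius `1/(k+1)` (any `k`), and the generic explicit endgame
  (`HandoffWeilEnergyExplicitEndgame`).

Result `weilGroundEnergy_le_of_summable_seed`: with `a = log λ − log θ + 1/(k+1)`,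
`ε(a) ≤ (3A/λ² · D_k)² · W · 2a e^{3a} / (((π²/6)M₂λ² − 3A/λ²) e^{-3/2})²`, where `M₂ ≤ ‖𝓜h(2)‖`,
`D_k = weilDecayConst φ_k`, `W = Σ'_ρ w(ρ)`.  For the Kaiser–Bessel seed of the paper Lemma KB′
(`A = 43000·λ¹⁶·e^{-2πλ²}·‖h‖`, `‖𝓜h(2)‖ ≍ e^{c}` unnormalised) this is `poly · e^{-4πλ²}` — the sharp
exponent; the seed lemma itself is NOT in the tree (paper: handoff/prove-1 ATTEMPT-10 §2).
No hypothesis on the zeros is used anywhere. Nothing here bears on RH (upper bound on an infimum).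
-/

set_option linter.dupNamespace false  -- the mandated namespace repeats `RiemannHypothesis`

noncomputable section

open Complex Filter Set Topology MeasureTheory
open scoped FourierTransform
open Literature.NumberTheory.LFunctions Literature.NumberTheory.LFunctions.WeilContinuous

namespace Summit.RiemannHypothesis.RiemannHypothesis.Theorems.HandoffRouteE

open Summit.RiemannHypothesis.RiemannHypothesis.Theorems


/-! ## Mollifier facts for every index `k` (Solo X/XVI had them for `k = 0` / radius `1`) -/

/-- `(g ⋆ φ_k)(x) = 0` for `|x| > R + r_k` when `g` vanishes outside `[-R, R]` (`r_k = 1/(k+1)` the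
outer radius of the bump) [Bombieri 2000 §2, support of a convolution]. -/
theorem weilConv_moll_eq_zero_of_radius {g : ℝ → ℂ} {R : ℝ} (hgs : ∀ u : ℝ, R < |u| → g u = 0)
    (k : ℕ) {x : ℝ} (hx : R + (bump k).rOut < |x|) : weilConv g (moll k) x = 0 := by
  rw [weilConv_apply]
  refine integral_eq_zero_of_ae (Eventually.of_forall fun u => ?_)
  simp only [Pi.zero_apply]
  rcases le_or_gt (bump k).rOut |x - u| with hu | hu
  · rw [moll_eq_zero hu, mul_zero]
  · have h2 : R < |u| := by
      have := abs_sub_abs_le_abs_sub x u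
      linarith
    rw [hgs u h2, zero_mul]

/-- Support of `g ⋆ φ_k` [Bombieri 2000 §2]. -/
theorem tsupport_weilConv_moll_subset {g : ℝ → ℂ} {R : ℝ} (hR : 0 ≤ R)
    (hgs : ∀ u : ℝ, R < |u| → g u = 0) (k : ℕ) :
    tsupport (weilConv g (moll k)) ⊆ Icc (-(R + (bump k).rOut)) (R + (bump k).rOut) := by
  have hr : 0 < (bump k).rOut := (bump k).rOut_pos
  refine closure_minimal (fun t ht => ?_) isClosed_Icc
  by_contra habs
  refine ht (weilConv_moll_eq_zero_of_radius hgs k ?_)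
  rcases le_or_gt 0 t with h0 | h0
  · rw [abs_of_nonneg h0]
    by_contra hle
    exact habs ⟨by linarith [not_lt.1 hle], not_lt.1 hle⟩
  · rw [abs_of_neg h0]
    by_contra hle
    exact habs ⟨by linarith [not_lt.1 hle], by linarith [not_lt.1 hle]⟩

/-- `‖φ̂_k(2)‖ ≥ e^{-3/2}` for every `k`: `φ_k ≥ 0` has mass one and lives on `[-1, 1]`
[Solo X `norm_weilMellin_moll_zero_two_ge`, verbatim with `0 ↦ k`]. -/
theorem norm_weilMellin_moll_two_ge (k : ℕ) :
    Real.exp (-(3 / 2 : ℝ)) ≤ ‖weilMellin (moll k) 2‖ := by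
  set n : ℝ → ℝ := fun t => (bump k).normed volume t with hn
  have hn0 : ∀ t, 0 ≤ n t := fun t => (bump k).nonneg_normed t
  have hnc : Continuous n := (bump k).continuous_normed
  have hns : HasCompactSupport n := (bump k).hasCompactSupport_normed
  have hsupp : ∀ t, n t ≠ 0 → -1 < t := by
    intro t ht
    have hmem : t ∈ Function.support ((bump k).normed volume) := ht
    rw [ContDiffBump.support_normed_eq] at hmem
    have h1 : |t| < (bump k).rOut := by simpa [Real.dist_eq] using hmem
    have h2 : |t| < 1 := h1.trans_le (bump_rOut_le_one k)
    linarith [neg_abs_le t]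
  have hI : Integrable (fun t : ℝ => moll k t * cexp ((2 - 1 / 2) * t)) volume :=
    integrable_weilIntegrand (continuous_moll k) (hasCompactSupport_moll k) 2
  have hre : (weilMellin (moll k) 2).re = ∫ t : ℝ, n t * Real.exp (3 / 2 * t) := by
    unfold weilMellin
    have h1 := Complex.reCLM.integral_comp_comm hI
    simp only [Complex.reCLM_apply] at h1
    rw [← h1]
    refine integral_congr_ae (Eventually.of_forall fun t => ?_)
    have e1 : (2 - 1 / 2 : ℂ) * (t : ℂ) = (((3 / 2 : ℝ) * t : ℝ) : ℂ) := by push_cast; ring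
    simp only [WeilContinuous.moll]
    rw [e1, ← Complex.ofReal_exp, ← Complex.ofReal_mul, Complex.ofReal_re]
  have hmono : ∫ t : ℝ, n t * Real.exp (-(3 / 2 : ℝ)) ≤ ∫ t : ℝ, n t * Real.exp (3 / 2 * t) := by
    refine integral_mono ((hnc.integrable_of_hasCompactSupport hns).mul_const _)
      ((hnc.mul (Real.continuous_exp.comp (continuous_const.mul continuous_id))).integrable_of_hasCompactSupport
        hns.mul_right) fun t => ?_
    simp only
    by_cases ht : n t = 0
    · rw [ht, zero_mul, zero_mul]
    · exact mul_le_mul_of_nonneg_left (Real.exp_le_exp.2 (by linarith [hsupp t ht])) (hn0 t)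
  have hmass : ∫ t : ℝ, n t * Real.exp (-(3 / 2 : ℝ)) = Real.exp (-(3 / 2 : ℝ)) := by
    rw [integral_mul_const, hn, (bump k).integral_normed, one_mul]
  calc Real.exp (-(3 / 2 : ℝ)) = ∫ t : ℝ, n t * Real.exp (-(3 / 2 : ℝ)) := hmass.symm
    _ ≤ (weilMellin (moll k) 2).re := by rw [hre]; exact hmono
    _ ≤ ‖weilMellin (moll k) 2‖ := Complex.re_le_norm _

/-! ## The assembly: an explicit ground-energy bound from an explicit seed -/

/-- **Theorem E♭, kernel form modulo the seed** [handoff/prove-1 ATTEMPT-11; Solo XII–XVI re-run with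
the Route E window]: let `h` be an even Schwartz seed with `h(0) = 0 = ∫ h`, `h = 0` on `(1, ∞)`, whose
Fourier transform has the summable envelope `‖𝓕h(ξ)‖ ≤ A ξ⁻²` for `ξ ≥ λ²` (`λ ≥ 2`), and let
`M₂ ≤ ‖𝓜h(2)‖` with `c_g := (π²/6) M₂ λ² − 3A/λ² > 0`.  Then for every `0 < θ < 1` and every
mollifier index `k`, with `a := log λ − log θ + r_k` (`r_k = 1/(k+1)`):
`ε(a) ≤ (3A/λ² · D_k)² · W · 2a e^{3a} / (c_g e^{-3/2})²`, `D_k = weilDecayConst φ_k`,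
`W = Σ'_ρ w(ρ)`.  No hypothesis on the zeros; `θ` enters only through `a`.  With a seed for which
`A ≍ poly(λ) e^{-2πλ²}` (Kaiser–Bessel, paper Lemma KB′) this is `poly · e^{-4πλ²}`.
[cite: Bombieri2000Weil, §4; ConnesConsani2023 (the E-map)] -/
theorem weilGroundEnergy_le_of_summable_seed (h : SchwartzMap ℝ ℂ) (heven : ∀ x, h (-x) = h x)
    (h0 : h 0 = 0) (hint : ∫ x : ℝ, h x = 0) (hsupp : ∀ x : ℝ, 1 < x → h x = 0)
    {lam : ℝ} (hlam : 2 ≤ lam) {A : ℝ} (hA : 0 ≤ A)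
    (hF : ∀ ξ : ℝ, lam ^ 2 ≤ ξ → ‖(𝓕 h : SchwartzMap ℝ ℂ) ξ‖ ≤ A * (ξ ^ 2)⁻¹)
    {M₂ : ℝ} (hM₂ : M₂ ≤ ‖mellin (fun x : ℝ => h x) 2‖)
    (hcg : 0 < Real.pi ^ 2 / 6 * M₂ * lam ^ 2 - 3 * A / lam ^ 2)
    {θ : ℝ} (hθ0 : 0 < θ) (hθ1 : θ < 1) (k : ℕ) :
    weilGroundEnergy (Real.log lam - Real.log θ + (bump k).rOut) ≤
      (3 * A / lam ^ 2 * weilDecayConst (moll k)) ^ 2 *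
        (∑' ρ : ZetaZeros.riemannZetaNontrivialZeros, weilZeroWeight (ρ : ℂ)) *
          (2 * (Real.log lam - Real.log θ + (bump k).rOut) *
            Real.exp (3 * (Real.log lam - Real.log θ + (bump k).rOut))) /
        ((Real.pi ^ 2 / 6 * M₂ * lam ^ 2 - 3 * A / lam ^ 2) * Real.exp (-(3 / 2 : ℝ))) ^ 2 := by
  have hlam1 : 1 ≤ lam := by linarith
  have hlam0 : 0 < lam := by linarith
  -- the E-map leak bound on `(0, 1/λ]` from the summable envelope (Solo XII-quant, `X = λ²`)
  have hE : ∀ u : ℝ, 0 < u → u ≤ lam⁻¹ → ‖eMapFn h lam u‖ ≤ 3 * A * (lam⁻¹ * u) := by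
    intro u hu hul
    have hX : 0 < lam ^ 2 := by positivity
    have hux : lam ^ 2 * u ≤ lam := by
      calc lam ^ 2 * u ≤ lam ^ 2 * lam⁻¹ := by gcongr
        _ = lam := by field_simp
    exact norm_eMapFn_le_of_fourier_decay h heven h0 hint hA hX hF hlam0 hu hux
  have hA3 : 0 ≤ 3 * A := by positivity
  -- window
  set g : ℝ → ℂ := winTestW h lam θ with hg
  have hgc : Continuous g := continuous_winTestW h hlam0 θ
  have hgs : HasCompactSupport g := hasCompactSupport_winTestW h hsupp hlam1 hθ0 hθ1
  set R : ℝ := Real.log lam - Real.log θ with hR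
  have hR0 : 0 ≤ R := by
    have := Real.log_nonneg hlam1
    have := Real.log_neg hθ0 hθ1
    rw [hR]; linarith
  have hgR : ∀ u : ℝ, R < |u| → g u = 0 := fun u hu => winTestW_eq_zero h hsupp hlam1 hθ0 hθ1 hu
  have hzero : ∀ ρ ∈ ZetaZeros.riemannZetaNontrivialZeros, ‖weilMellin g ρ‖ ≤ 3 * A / lam ^ 2 :=
    fun ρ hρ => norm_weilMellin_winTestW_le_of_bound h heven h0 hint hsupp hA3 hlam1 hθ1 hE hρ
  have hg2 : Real.pi ^ 2 / 6 * M₂ * lam ^ 2 - 3 * A / lam ^ 2 ≤ ‖weilMellin g 2‖ := by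
    have h1 := norm_weilMellin_winTestW_two_ge_of_bound h heven h0 hint hsupp hA3 hlam1 hθ1 hE
    have h2 : Real.pi ^ 2 / 6 * M₂ * lam ^ 2 ≤
        Real.pi ^ 2 / 6 * ‖mellin (fun x : ℝ => h x) 2‖ * lam ^ 2 := by
      have : 0 ≤ Real.pi ^ 2 / 6 * lam ^ 2 := by positivity
      nlinarith
    rw [hg] ; linarith
  -- mollifier and the convolution as a Weil test supported in `[-a, a]`
  have hm : IsWeilTest (moll k) := isWeilTest_moll k
  have hgt : IsWeilTest (weilConv g (moll k)) := isWeilTest_weilConv_moll hgc hgs k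
  have hr : 0 < (bump k).rOut := (bump k).rOut_pos
  have ha : 0 < R + (bump k).rOut := by linarith
  have hsuppk : tsupport (weilConv g (moll k)) ⊆ Icc (-(R + (bump k).rOut)) (R + (bump k).rOut) :=
    tsupport_weilConv_moll_subset hR0 hgR k
  have hcm : 0 < Real.exp (-(3 / 2 : ℝ)) := Real.exp_pos _
  -- the window test need not be smooth: the generic endgame only needs `g ⋆ φ_k` to be a Weil test,
  -- so we run the pointwise form directly
  have hmul : ∀ s : ℂ, weilMellin (weilConv g (moll k)) s = weilMellin g s * weilMellin (moll k) s :=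
    fun s => weilMellin_weilConv_moll hgc hgs k s
  set D : ℝ := weilDecayConst (moll k) with hD
  have hD0 : 0 ≤ D := weilDecayConst_nonneg _
  have hzero' : ∀ ρ ∈ ZetaZeros.riemannZetaNontrivialZeros,
      ‖weilMellin (weilConv g (moll k)) ρ‖ ^ 2 ≤ (3 * A / lam ^ 2 * D) ^ 2 / (1 + ρ.im ^ 2) ^ 2 := by
    intro ρ hρ
    obtain ⟨-, hre, hre1⟩ := mem_riemannZetaNontrivialZeros_iff_holds.1 hρ
    have hpos : 0 < 1 + ρ.im ^ 2 := by positivity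
    have h1 : ‖weilMellin g ρ‖ ≤ 3 * A / lam ^ 2 := hzero ρ hρ
    have h2 : ‖weilMellin (moll k) ρ‖ ≤ D / (1 + ρ.im ^ 2) := norm_weilMellin_le hm hre.le hre1.le
    have h3 : ‖weilMellin (weilConv g (moll k)) ρ‖ ≤ 3 * A / lam ^ 2 * D / (1 + ρ.im ^ 2) := by
      rw [hmul, norm_mul, mul_div_assoc]
      exact mul_le_mul h1 h2 (norm_nonneg _) (by positivity)
    calc ‖weilMellin (weilConv g (moll k)) ρ‖ ^ 2 ≤ (3 * A / lam ^ 2 * D / (1 + ρ.im ^ 2)) ^ 2 :=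
        pow_le_pow_left₀ (norm_nonneg _) h3 2
      _ = (3 * A / lam ^ 2 * D) ^ 2 / (1 + ρ.im ^ 2) ^ 2 := by rw [div_pow]
  have h2' : (Real.pi ^ 2 / 6 * M₂ * lam ^ 2 - 3 * A / lam ^ 2) * Real.exp (-(3 / 2 : ℝ)) ≤
      ‖weilMellin (weilConv g (moll k)) 2‖ := by
    rw [hmul, norm_mul]
    exact mul_le_mul hg2 (norm_weilMellin_moll_two_ge k) hcm.le (norm_nonneg _)
  exact weilGroundEnergy_le_of_zero_decay hgt ha hsuppk (by positivity) (by positivity) hzero' h2'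

end Summit.RiemannHypothesis.RiemannHypothesis.Theorems.HandoffRouteE
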